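import Mathlib.NumberTheory.Chebyshev
import Mathlib.Analysis.SpecialFunctions.Sqrt
import Literature.NumberTheory.LFunctions.RHConditionalFacts
import Literature.NumberTheory.LFunctions.RHClassicalEquivalentsVonKochProofs
import Literature.NumberTheory.LFunctions.LogIntegralBridgeProofs
import HarnessLib

/-!
# rh.S20 discharged: von Koch's criterion `RH ↔ π(x) = li(x) + O(√x log x)`

Trunk T-ANT (`NumberTheory/LFunctions`), family RH. Companion ("Proofs") file of
`Literature/NumberTheory/LFunctions/RHConditionalFacts.lean` for its **rh.S20** named fact
`Literature.NumberTheory.LFunctions.von_koch` (H. von Koch, *Sur la distribution des nombres premiers*, Acta Math. 24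
(1901), 159–182, Note additionnelle, p. 182: "Dans l'hypothèse `R(ρ) = 1/2` il est certain que
l'erreur commise en posant `F(x) = Li(x)` est inférieure à `log x · √x`, multiplié par une
constante", `F = π`; Montgomery–Vaughan, *Multiplicative Number Theory I*, Thm. 13.1, eq. (13.4)
for `⇒` and §15.1 (with Thm. 1.3) for `⇐`).

The analytic content — `RH ↔ θ(x) − x = O(x^{1/2} log² x)` — is the in-tree theorem
`Literature.NumberTheory.LFunctions.riemannHypothesis_iff_chebyshevTheta_isBigO_holds`
(`RHClassicalEquivalentsVonKochProofs.lean`: the truncated explicit formula under RH for `⇒`,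
`VonKochTheorem.lean`; Mellin continuation of `−ζ'/ζ` and the identity theorem for `⇐`,
`VonKochConverse.lean`). This file supplies the two partial-summation transfers between the
`θ` form and the `π`/`li` form, following Montgomery–Vaughan's proof of Thm. 13.1:

* (13.5) `π(x) = ∫₂ˣ du/log u + (θ(x) − x)/log x + 2/log 2 + ∫₂ˣ (θ(u) − u)/(u log² u) du`
  (`VonKochTransfer.primeCounting_sub_logIntegral_eq`; here with `li = Literature.logIntegral`, the p.v.
  from `0`, so that `∫₂ˣ du/log u = li x − li 2`, `Literature.NumberTheory.LFunctions.logIntegral_sub_logIntegral_two_holds`),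
  whence `θ(x) − x ≪ √x log² x` gives `π(x) − li(x) ≪ √x log x`
  (`VonKochTransfer.isBigO_primeCounting_sub_logIntegral_of_theta`);
* the dual identity `θ(x) − x = (π(x) − li x) log x − ∫₂ˣ (π(u) − li u) du/u + (li 2 log 2 − 2)`
  (`VonKochTransfer.theta_sub_self_eq`, from Mathlib's
  `Chebyshev.theta_eq_primeCounting_mul_log_sub_integral`
  and `∫₂ˣ li(u) du/u = li x log x − x − (li 2 log 2 − 2)`), whence `π(x) − li(x) ≪ √x log x`
  gives `θ(x) − x ≪ √x log² x` (`VonKochTransfer.isBigO_theta_of_primeCounting_sub_logIntegral`).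

Both estimates of the integrals are instances of one lemma
(`VonKochTransfer.isBigO_intervalIntegral_of_abs_le`: `|g| ≤ C h` on `[T, ∞)` and
`∫_T^x h ≤ H(x)` give
`∫₂ˣ g = O(H)`), with `h(u) = 1/√u`, `H(x) = 2√x`, resp. `h(u) = log u/√u`, `H(x) = 2√x log x`.

## Main result

* `Literature.RH.von_koch_holds : von_koch` — depends only on `propext`, `Classical.choice`,
  `Quot.sound`.

## References

* H. von Koch, *Sur la distribution des nombres premiers*, Acta Math. 24 (1901), 159–182,
  doi:10.1007/BF02403071, §7 and Note additionnelle (p. 182).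
* H. L. Montgomery, R. C. Vaughan, *Multiplicative Number Theory I. Classical Theory*, Cambridge
  Studies in Advanced Mathematics 97, CUP 2007, Thm. 13.1 with (13.5), and §15.1.
-/

noncomputable section

open Real Filter Asymptotics MeasureTheory Set
open scoped Topology Chebyshev

namespace Literature.NumberTheory.LFunctions

/-! The helper lemmas live in the sub-namespace `Literature.RH.VonKochTransfer` (the shared namespace
`Literature.RH` also hosts `SchoenfeldExplicit.lean`, whose `primeCounting_sub_logIntegral_eq` is the
`ξ`-version of (13.5)); only the three final theorems are declared in `Literature.RH` itself. -/

namespace VonKochTransfer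

/-! ### The logarithmic integral: two integrations by parts -/

/-- Points of `uIcc 2 x` exceed `1` when `x > 1`. [folklore] -/
private theorem one_lt_of_mem_uIcc_two {x t : ℝ} (hx : 1 < x) (ht : t ∈ uIcc (2 : ℝ) x) :
    1 < t := by
  rcases mem_uIcc.1 ht with h | h <;> linarith [h.1]

/-- `li x = x/log x + ∫₂ˣ dt/log² t + (li 2 − 2/log 2)` for `x > 1` (one integration by parts of
`∫₂ˣ dt/log t = li x − li 2`; Montgomery–Vaughan (13.5) uses it in the form
`∫₂ˣ du/log u − x/log x + 2/log 2 = ∫₂ˣ du/log² u`).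
[cite: MontgomeryVaughan2007, Thm. 13.1 proof (13.5)] -/
theorem logIntegral_eq_div_log_add_integral {x : ℝ} (hx : 1 < x) :
    logIntegral x = x / Real.log x + (∫ t in (2 : ℝ)..x, 1 / Real.log t ^ 2)
      + (logIntegral 2 - 2 / Real.log 2) := by
  have h1 := logIntegral_eq_offsetLogIntegral_add_logIntegral_two hx
  have h2 := offsetLogIntegralPow_integration_by_parts 1 hx
  rw [offsetLogIntegralPow_one] at h2
  have h3 : offsetLogIntegralPow (1 + 1) x = ∫ t in (2 : ℝ)..x, 1 / Real.log t ^ 2 := by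
    simp only [offsetLogIntegralPow, inv_pow, one_div]
  rw [h1, h2, h3]
  simp only [pow_one, Nat.cast_one, one_mul, div_eq_mul_inv]
  ring

/-- `li` is continuous on `(1, ∞)` (it is differentiable there, `li' = 1/log`). [folklore] -/
theorem continuousOn_logIntegral : ContinuousOn logIntegral (Ioi 1) := fun _ ht ↦
  (hasDerivAt_logIntegral_holds ht).continuousAt.continuousWithinAt

/-- `u ↦ li(u)/u` is interval integrable on `[2, x]`, `x > 1`. [folklore] -/
theorem intervalIntegrable_logIntegral_div {x : ℝ} (hx : 1 < x) :
    IntervalIntegrable (fun t ↦ logIntegral t / t) volume 2 x := by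
  refine ContinuousOn.intervalIntegrable ?_
  refine (continuousOn_logIntegral.mono fun t ht ↦ ?_).div continuousOn_id fun t ht ↦ ?_
  · exact one_lt_of_mem_uIcc_two hx ht
  · exact (zero_lt_one.trans (one_lt_of_mem_uIcc_two hx ht)).ne'

/-- `∫₂ˣ li(u) du/u = li x log x − x − (li 2 log 2 − 2)` for `x > 1`, since
`d/du (li u log u − u) = li(u)/u`. [folklore] -/
theorem integral_logIntegral_div {x : ℝ} (hx : 1 < x) :
    ∫ t in (2 : ℝ)..x, logIntegral t / t
      = logIntegral x * Real.log x - x - (logIntegral 2 * Real.log 2 - 2) := by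
  have hderiv : ∀ t ∈ uIcc (2 : ℝ) x,
      HasDerivAt (logIntegral * Real.log - id) (logIntegral t / t) t := by
    intro t ht
    have ht1 : 1 < t := one_lt_of_mem_uIcc_two hx ht
    have ht0 : t ≠ 0 := by positivity
    have hlog : Real.log t ≠ 0 := (Real.log_pos ht1).ne'
    have h := ((hasDerivAt_logIntegral_holds ht1).mul (Real.hasDerivAt_log ht0)).sub
      (hasDerivAt_id t)
    refine h.congr_deriv ?_
    rw [inv_mul_cancel₀ hlog, div_eq_mul_inv]
    ring
  rw [intervalIntegral.integral_eq_sub_of_hasDerivAt hderiv (intervalIntegrable_logIntegral_div hx)]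
  simp only [Pi.sub_apply, Pi.mul_apply, id_eq]

/-! ### The two exact identities (Montgomery–Vaughan (13.5) and its dual) -/

/-- `u ↦ (θ(u) − u)/(u log² u)` is interval integrable on `[2, x]` (`θ` is monotone).
[folklore] -/
theorem intervalIntegrable_theta_sub_div {x : ℝ} (hx : 1 < x) :
    IntervalIntegrable (fun t ↦ (θ t - t) / (t * Real.log t ^ 2)) volume 2 x := by
  have h1 : IntervalIntegrable (fun t ↦ θ t - t) volume 2 x :=
    Chebyshev.theta_mono.intervalIntegrable.sub (continuous_id.intervalIntegrable 2 x)
  refine (h1.mul_continuousOn (g := fun t ↦ (t * Real.log t ^ 2)⁻¹) ?_).congr ?_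
  · have hcont : ContinuousOn (fun t : ℝ ↦ t * Real.log t ^ 2) (uIcc 2 x) := by
      refine continuousOn_id.mul ((Real.continuousOn_log.mono fun t ht ↦ ?_).pow 2)
      simp only [mem_compl_iff, mem_singleton_iff]
      exact (zero_lt_one.trans (one_lt_of_mem_uIcc_two hx ht)).ne'
    refine hcont.inv₀ fun t ht ↦ ?_
    have ht1 := one_lt_of_mem_uIcc_two hx ht
    have : Real.log t ≠ 0 := (Real.log_pos ht1).ne'
    positivity
  · exact fun t _ ↦ (div_eq_mul_inv _ _).symm

/-- `u ↦ (π(u) − li u)/u` is interval integrable on `[2, x]` (`π ∘ ⌊·⌋₊` is monotone, `li` is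
continuous on `(1, ∞)`). [folklore] -/
theorem intervalIntegrable_primeCounting_sub_logIntegral_div {x : ℝ} (hx : 1 < x) :
    IntervalIntegrable (fun t ↦ ((Nat.primeCounting ⌊t⌋₊ : ℝ) - logIntegral t) / t)
      volume 2 x := by
  have hmono : Monotone fun t : ℝ ↦ (Nat.primeCounting ⌊t⌋₊ : ℝ) := by
    intro a b hab
    show (Nat.primeCounting ⌊a⌋₊ : ℝ) ≤ Nat.primeCounting ⌊b⌋₊
    exact_mod_cast Nat.monotone_primeCounting (Nat.floor_le_floor hab)
  have h1 : IntervalIntegrable (fun t ↦ (Nat.primeCounting ⌊t⌋₊ : ℝ) / t) volume 2 x := by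
    refine (hmono.intervalIntegrable.mul_continuousOn (g := fun t ↦ t⁻¹) ?_).congr ?_
    · exact continuousOn_id.inv₀ fun t ht ↦
        (zero_lt_one.trans (one_lt_of_mem_uIcc_two hx ht)).ne'
    · exact fun t _ ↦ (div_eq_mul_inv _ _).symm
  refine (h1.sub (intervalIntegrable_logIntegral_div hx)).congr ?_
  exact fun t _ ↦ (sub_div _ _ _).symm

/-- **Montgomery–Vaughan (13.5)**, with `li = Literature.logIntegral`: for `x ≥ 2`,
`π(x) − li x = (θ(x) − x)/log x + ∫₂ˣ (θ(u) − u)/(u log² u) du + (2/log 2 − li 2)`.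
[cite: MontgomeryVaughan2007, Thm. 13.1 proof (13.5)] -/
theorem primeCounting_sub_logIntegral_eq {x : ℝ} (hx : 2 ≤ x) :
    (Nat.primeCounting ⌊x⌋₊ : ℝ) - logIntegral x
      = (θ x - x) / Real.log x + (∫ t in (2 : ℝ)..x, (θ t - t) / (t * Real.log t ^ 2))
        + (2 / Real.log 2 - logIntegral 2) := by
  have hx1 : 1 < x := by linarith
  have hlogx : Real.log x ≠ 0 := (Real.log_pos hx1).ne'
  have hθ : IntervalIntegrable (fun t ↦ θ t / (t * Real.log t ^ 2)) volume 2 x := by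
    rw [intervalIntegrable_iff, uIoc_of_le hx, ← integrableOn_Icc_iff_integrableOn_Ioc]
    exact Chebyshev.integrableOn_theta_div_id_mul_log_sq x
  have hli : IntervalIntegrable (fun t ↦ 1 / Real.log t ^ 2) volume 2 x :=
    Chebyshev.intervalIntegrable_one_div_log_sq one_lt_two hx1
  have hsub : (∫ t in (2 : ℝ)..x, (θ t - t) / (t * Real.log t ^ 2))
      = (∫ t in (2 : ℝ)..x, θ t / (t * Real.log t ^ 2))
        - ∫ t in (2 : ℝ)..x, 1 / Real.log t ^ 2 := by
    rw [← intervalIntegral.integral_sub hθ hli]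
    refine intervalIntegral.integral_congr fun t ht ↦ ?_
    have ht1 := one_lt_of_mem_uIcc_two hx1 ht
    have : Real.log t ≠ 0 := (Real.log_pos ht1).ne'
    have ht0 : t ≠ 0 := by positivity
    field_simp
  rw [Chebyshev.primeCounting_eq_theta_div_log_add_integral hx,
    logIntegral_eq_div_log_add_integral hx1, hsub]
  field_simp
  ring

/-- The dual of Montgomery–Vaughan (13.5): for `x ≥ 2`,
`θ(x) − x = (π(x) − li x) log x − ∫₂ˣ (π(u) − li u) du/u + (li 2 log 2 − 2)`
(Mathlib's `Chebyshev.theta_eq_primeCounting_mul_log_sub_integral` and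
`∫₂ˣ li(u) du/u = li x log x − x − (li 2 log 2 − 2)`). [folklore] -/
theorem theta_sub_self_eq {x : ℝ} (hx : 2 ≤ x) :
    θ x - x
      = ((Nat.primeCounting ⌊x⌋₊ : ℝ) - logIntegral x) * Real.log x
        - (∫ t in (2 : ℝ)..x, ((Nat.primeCounting ⌊t⌋₊ : ℝ) - logIntegral t) / t)
        + (logIntegral 2 * Real.log 2 - 2) := by
  have hx1 : 1 < x := by linarith
  have hπ : IntervalIntegrable (fun t ↦ (Nat.primeCounting ⌊t⌋₊ : ℝ) / t) volume 2 x := by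
    have := (intervalIntegrable_primeCounting_sub_logIntegral_div hx1).add
      (intervalIntegrable_logIntegral_div hx1)
    refine this.congr fun t _ ↦ ?_
    simp only [sub_div, sub_add_cancel]
  have hsub : (∫ t in (2 : ℝ)..x, ((Nat.primeCounting ⌊t⌋₊ : ℝ) - logIntegral t) / t)
      = (∫ t in (2 : ℝ)..x, (Nat.primeCounting ⌊t⌋₊ : ℝ) / t)
        - ∫ t in (2 : ℝ)..x, logIntegral t / t := by
    rw [← intervalIntegral.integral_sub hπ (intervalIntegrable_logIntegral_div hx1)]
    exact intervalIntegral.integral_congr fun t _ ↦ by simp [sub_div]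
  rw [Chebyshev.theta_eq_primeCounting_mul_log_sub_integral hx, hsub,
    integral_logIntegral_div hx1]
  ring

/-! ### Estimating `∫₂ˣ g` from a bound `|g| ≤ C h` on `[T, ∞)` -/

/-- If `g` is interval integrable on every `[2, x]`, `h` is continuous on `[T, ∞)` (`T ≥ 2`) and
`|g(u)| ≤ C h(u)` for `u ≥ T`, then `|∫₂ˣ g| ≤ |∫₂ᵀ g| + C ∫_Tˣ h` for `x ≥ T`. [folklore] -/
theorem abs_intervalIntegral_le_of_abs_le {g h : ℝ → ℝ} {C T : ℝ} (hT : 2 ≤ T)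
    (hg : ∀ x, 2 ≤ x → IntervalIntegrable g volume 2 x)
    (hh : ContinuousOn h (Ici T)) (hb : ∀ t, T ≤ t → |g t| ≤ C * h t) {x : ℝ} (hx : T ≤ x) :
    |∫ t in (2 : ℝ)..x, g t| ≤ |∫ t in (2 : ℝ)..T, g t| + C * ∫ t in T..x, h t := by
  have hgT : IntervalIntegrable g volume T x := (hg T hT).symm.trans (hg x (hT.trans hx))
  rw [← intervalIntegral.integral_add_adjacent_intervals (hg T hT) hgT]
  refine (abs_add_le _ _).trans (add_le_add le_rfl ?_)
  have hhc : ContinuousOn h (uIcc T x) := hh.mono fun t ht ↦ by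
    rw [uIcc_of_le hx] at ht
    exact ht.1
  have hhint : IntervalIntegrable (fun t ↦ C * h t) volume T x :=
    hhc.intervalIntegrable.const_mul C
  have key : ‖∫ t in T..x, g t‖ ≤ ∫ t in T..x, C * h t :=
    intervalIntegral.norm_integral_le_of_norm_le hx
      (Eventually.of_forall fun t ht ↦ by rw [Real.norm_eq_abs]; exact hb t ht.1.le) hhint
  rwa [intervalIntegral.integral_const_mul, Real.norm_eq_abs] at key

/-- With the hypotheses of `abs_intervalIntegral_le_of_abs_le` and `∫_Tˣ h ≤ H(x)` for `x ≥ T`,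
`H ≥ 1` eventually: `∫₂ˣ g = O(H(x))` as `x → ∞`. [folklore] -/
theorem isBigO_intervalIntegral_of_abs_le {g h H : ℝ → ℝ} {C T : ℝ} (hT : 2 ≤ T) (hC : 0 ≤ C)
    (hg : ∀ x, 2 ≤ x → IntervalIntegrable g volume 2 x)
    (hh : ContinuousOn h (Ici T)) (hb : ∀ t, T ≤ t → |g t| ≤ C * h t)
    (hH : ∀ x, T ≤ x → ∫ t in T..x, h t ≤ H x) (hH1 : ∀ᶠ x in atTop, 1 ≤ H x) :
    (fun x ↦ ∫ t in (2 : ℝ)..x, g t) =O[atTop] H := by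
  refine IsBigO.of_bound (|∫ t in (2 : ℝ)..T, g t| + C) ?_
  filter_upwards [eventually_ge_atTop T, hH1] with x hx hx1
  have hHx : 0 ≤ H x := zero_le_one.trans hx1
  rw [Real.norm_eq_abs, Real.norm_eq_abs, abs_of_nonneg hHx]
  calc |∫ t in (2 : ℝ)..x, g t| ≤ |∫ t in (2 : ℝ)..T, g t| + C * ∫ t in T..x, h t :=
        abs_intervalIntegral_le_of_abs_le hT hg hh hb hx
    _ ≤ |∫ t in (2 : ℝ)..T, g t| * H x + C * H x :=
        add_le_add (le_mul_of_one_le_right (abs_nonneg _) hx1)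
          (mul_le_mul_of_nonneg_left (hH x hx) hC)
    _ = (|∫ t in (2 : ℝ)..T, g t| + C) * H x := by ring

/-- `∫_Tˣ du/√u = 2√x − 2√T ≤ 2√x` for `0 < T ≤ x`. [folklore] -/
theorem integral_inv_sqrt_le {T x : ℝ} (hT : 0 < T) (hx : T ≤ x) :
    ∫ t in T..x, (Real.sqrt t)⁻¹ ≤ 2 * Real.sqrt x := by
  have hderiv : ∀ t ∈ uIcc T x, HasDerivAt (fun u ↦ 2 * Real.sqrt u) ((Real.sqrt t)⁻¹) t := by
    intro t ht
    have ht0 : 0 < t := by rcases mem_uIcc.1 ht with h | h <;> linarith [h.1]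
    have hst : Real.sqrt t ≠ 0 := (Real.sqrt_pos.2 ht0).ne'
    refine ((Real.hasDerivAt_sqrt ht0.ne').const_mul 2).congr_deriv ?_
    field_simp
  have hint : IntervalIntegrable (fun t ↦ (Real.sqrt t)⁻¹) volume T x := by
    refine (Real.continuous_sqrt.continuousOn.inv₀ fun t ht ↦ ?_).intervalIntegrable
    have ht0 : 0 < t := by rcases mem_uIcc.1 ht with h | h <;> linarith [h.1]
    exact (Real.sqrt_pos.2 ht0).ne'
  rw [intervalIntegral.integral_eq_sub_of_hasDerivAt hderiv hint]
  linarith [Real.sqrt_nonneg T]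

/-- `∫_Tˣ log u du/√u ≤ 2√x log x` for `1 ≤ T ≤ x`. [folklore] -/
theorem integral_inv_sqrt_mul_log_le {T x : ℝ} (hT : 1 ≤ T) (hx : T ≤ x) :
    ∫ t in T..x, (Real.sqrt t)⁻¹ * Real.log t ≤ 2 * Real.sqrt x * Real.log x := by
  have hT0 : 0 < T := by linarith
  have hcont_inv : ContinuousOn (fun t ↦ (Real.sqrt t)⁻¹) (uIcc T x) := by
    refine Real.continuous_sqrt.continuousOn.inv₀ fun t ht ↦ ?_
    have ht0 : 0 < t := by rcases mem_uIcc.1 ht with h | h <;> linarith [h.1]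
    exact (Real.sqrt_pos.2 ht0).ne'
  have hcont_log : ContinuousOn Real.log (uIcc T x) := Real.continuousOn_log.mono fun t ht ↦ by
    simp only [mem_compl_iff, mem_singleton_iff]
    have ht0 : 0 < t := by rcases mem_uIcc.1 ht with h | h <;> linarith [h.1]
    exact ht0.ne'
  calc ∫ t in T..x, (Real.sqrt t)⁻¹ * Real.log t
      ≤ ∫ t in T..x, (Real.sqrt t)⁻¹ * Real.log x := by
        refine intervalIntegral.integral_mono_on hx ?_ ?_ fun t ht ↦ ?_
        · exact (hcont_inv.mul hcont_log).intervalIntegrable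
        · exact (hcont_inv.mul continuousOn_const).intervalIntegrable
        · have ht0 : 0 < t := by linarith [ht.1]
          exact mul_le_mul_of_nonneg_left (Real.log_le_log ht0 ht.2)
            (inv_nonneg.2 (Real.sqrt_nonneg t))
    _ = (∫ t in T..x, (Real.sqrt t)⁻¹) * Real.log x :=
        intervalIntegral.integral_mul_const (Real.log x) fun t ↦ (Real.sqrt t)⁻¹
    _ ≤ 2 * Real.sqrt x * Real.log x :=
        mul_le_mul_of_nonneg_right (integral_inv_sqrt_le hT0 hx) (Real.log_nonneg (by linarith))

/-- `√x ≥ 1` and `log x ≥ 1` for `x ≥ e`. [folklore] -/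
private theorem eventually_one_le_sqrt_and_log :
    ∀ᶠ x : ℝ in atTop, 1 ≤ Real.sqrt x ∧ 1 ≤ Real.log x := by
  filter_upwards [eventually_ge_atTop (Real.exp 1)] with x hx
  have hx1 : 1 ≤ x := by linarith [Real.add_one_le_exp (1 : ℝ)]
  refine ⟨by rw [← Real.sqrt_one]; exact Real.sqrt_le_sqrt hx1, ?_⟩
  rw [← Real.log_exp 1]
  exact Real.log_le_log (Real.exp_pos 1) hx

/-- A constant is `O(b)` at `+∞` as soon as `b ≥ 1` eventually. [folklore] -/
private theorem isBigO_const_of_one_le {b : ℝ → ℝ} (hb : ∀ᶠ x in atTop, 1 ≤ b x) (c : ℝ) :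
    (fun _ : ℝ ↦ c) =O[atTop] b := by
  refine IsBigO.of_bound |c| ?_
  filter_upwards [hb] with x hx
  rw [Real.norm_eq_abs, Real.norm_eq_abs, abs_of_nonneg (zero_le_one.trans hx)]
  exact le_mul_of_one_le_right (abs_nonneg c) hx

/-! ### The two transfers -/

/-- **Montgomery–Vaughan Thm. 13.1, (13.3) ⇒ (13.4)** (unconditionally, as an implication
between error terms): if `θ(x) − x = O(x^{1/2} log² x)` then `π(x) − li(x) = O(√x log x)`;
by (13.5), the term `(θ(x) − x)/log x` is `O(√x log x)` and the integral is
`O(∫₂ˣ du/√u) = O(√x)`.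
[cite: MontgomeryVaughan2007, Thm. 13.1 proof, (13.3) ⇒ (13.4) via (13.5)] -/
theorem isBigO_primeCounting_sub_logIntegral_of_theta
    (hθ : (fun x ↦ θ x - x) =O[atTop] fun x ↦ x ^ (1 / 2 : ℝ) * Real.log x ^ 2) :
    (fun x : ℝ ↦ (Nat.primeCounting ⌊x⌋₊ : ℝ) - logIntegral x) =O[atTop]
      fun x ↦ Real.sqrt x * Real.log x := by
  obtain ⟨C, hC0, hC⟩ := hθ.exists_pos
  obtain ⟨T₀, hT₀⟩ := eventually_atTop.1 hC.bound
  set T := max T₀ 2 with hTdef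
  have hT2 : 2 ≤ T := le_max_right _ _
  have hbd : ∀ t, T ≤ t → |θ t - t| ≤ C * (Real.sqrt t * Real.log t ^ 2) := by
    intro t ht
    have ht1 : 1 < t := by linarith
    have := hT₀ t ((le_max_left _ _).trans ht)
    rwa [Real.norm_eq_abs, Real.norm_eq_abs, ← Real.sqrt_eq_rpow,
      abs_of_nonneg (mul_nonneg (Real.sqrt_nonneg t) (pow_nonneg (Real.log_pos ht1).le 2))]
      at this
  -- (i) the boundary term `(θ x − x)/log x`
  have h1 : (fun x ↦ (θ x - x) / Real.log x) =O[atTop] fun x ↦ Real.sqrt x * Real.log x := by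
    refine IsBigO.of_bound C ?_
    filter_upwards [eventually_ge_atTop T] with x hx
    have hx1 : 1 < x := by linarith
    have hlog : 0 < Real.log x := Real.log_pos hx1
    rw [Real.norm_eq_abs, Real.norm_eq_abs, abs_div, abs_of_pos hlog, div_le_iff₀ hlog,
      abs_of_nonneg (mul_nonneg (Real.sqrt_nonneg x) hlog.le)]
    calc |θ x - x| ≤ C * (Real.sqrt x * Real.log x ^ 2) := hbd x hx
      _ = C * (Real.sqrt x * Real.log x) * Real.log x := by ring
  -- (ii) the integral `∫₂ˣ (θ u − u)/(u log² u) du = O(√x)`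
  have h2 : (fun x ↦ ∫ t in (2 : ℝ)..x, (θ t - t) / (t * Real.log t ^ 2)) =O[atTop]
      fun x ↦ Real.sqrt x * Real.log x := by
    have h2' : (fun x ↦ ∫ t in (2 : ℝ)..x, (θ t - t) / (t * Real.log t ^ 2)) =O[atTop]
        fun x ↦ 2 * Real.sqrt x := by
      refine isBigO_intervalIntegral_of_abs_le (h := fun t ↦ (Real.sqrt t)⁻¹) hT2 hC0.le
        (fun x hx ↦ intervalIntegrable_theta_sub_div (by linarith)) ?_ ?_
        (fun x hx ↦ integral_inv_sqrt_le (by linarith) hx) ?_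
      · refine Real.continuous_sqrt.continuousOn.inv₀ fun t ht ↦ ?_
        have ht0 : 0 < t := by linarith [mem_Ici.1 ht]
        exact (Real.sqrt_pos.2 ht0).ne'
      · intro t ht
        have ht1 : 1 < t := by linarith
        have ht0 : 0 < t := by linarith
        have hlog : 0 < Real.log t := Real.log_pos ht1
        have hst : 0 < Real.sqrt t := Real.sqrt_pos.2 ht0
        rw [abs_div, abs_of_pos (by positivity : 0 < t * Real.log t ^ 2),
          div_le_iff₀ (by positivity)]
        calc |θ t - t| ≤ C * (Real.sqrt t * Real.log t ^ 2) := hbd t ht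
          _ = C * (Real.sqrt t)⁻¹ * (t * Real.log t ^ 2) := by
              rw [← Real.sqrt_div_self]
              field_simp
      · filter_upwards [eventually_one_le_sqrt_and_log] with x hx
        linarith [hx.1]
    refine h2'.trans (IsBigO.of_bound 2 ?_)
    filter_upwards [eventually_one_le_sqrt_and_log] with x hx
    rw [Real.norm_eq_abs, Real.norm_eq_abs, abs_of_nonneg (by positivity),
      abs_of_nonneg (mul_nonneg (Real.sqrt_nonneg x) (zero_le_one.trans hx.2))]
    nlinarith [mul_nonneg (Real.sqrt_nonneg x) (sub_nonneg.2 hx.2)]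
  -- (iii) the constant
  have h3 := isBigO_const_of_one_le (b := fun x ↦ Real.sqrt x * Real.log x) ?_
    (2 / Real.log 2 - logIntegral 2)
  · refine ((h1.add h2).add h3).congr' ?_ EventuallyEq.rfl
    filter_upwards [eventually_ge_atTop 2] with x hx
    exact (primeCounting_sub_logIntegral_eq hx).symm
  · filter_upwards [eventually_one_le_sqrt_and_log] with x hx
    nlinarith [hx.1, hx.2]

/-- The converse transfer: if `π(x) − li(x) = O(√x log x)` then `θ(x) − x = O(x^{1/2} log² x)`;
by the dual identity `theta_sub_self_eq`, the term `(π(x) − li x) log x` is `O(√x log² x)` and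
the integral is `O(∫₂ˣ log u du/√u) = O(√x log x)`. [folklore] -/
theorem isBigO_theta_of_primeCounting_sub_logIntegral
    (hπ : (fun x : ℝ ↦ (Nat.primeCounting ⌊x⌋₊ : ℝ) - logIntegral x) =O[atTop]
      fun x ↦ Real.sqrt x * Real.log x) :
    (fun x ↦ θ x - x) =O[atTop] fun x ↦ x ^ (1 / 2 : ℝ) * Real.log x ^ 2 := by
  simp_rw [← Real.sqrt_eq_rpow]
  obtain ⟨C, hC0, hC⟩ := hπ.exists_pos
  obtain ⟨T₀, hT₀⟩ := eventually_atTop.1 hC.bound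
  set T := max T₀ 2 with hTdef
  have hT2 : 2 ≤ T := le_max_right _ _
  have hbd : ∀ t, T ≤ t →
      |(Nat.primeCounting ⌊t⌋₊ : ℝ) - logIntegral t| ≤ C * (Real.sqrt t * Real.log t) := by
    intro t ht
    have ht1 : 1 < t := by linarith
    have := hT₀ t ((le_max_left _ _).trans ht)
    rwa [Real.norm_eq_abs, Real.norm_eq_abs,
      abs_of_nonneg (mul_nonneg (Real.sqrt_nonneg t) (Real.log_pos ht1).le)] at this
  -- (i) the boundary term `(π(x) − li x) log x`
  have h1 : (fun x ↦ ((Nat.primeCounting ⌊x⌋₊ : ℝ) - logIntegral x) * Real.log x) =O[atTop]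
      fun x ↦ Real.sqrt x * Real.log x ^ 2 := by
    refine IsBigO.of_bound C ?_
    filter_upwards [eventually_ge_atTop T] with x hx
    have hx1 : 1 < x := by linarith
    have hlog : 0 < Real.log x := Real.log_pos hx1
    rw [Real.norm_eq_abs, Real.norm_eq_abs, abs_mul, abs_of_pos hlog,
      abs_of_nonneg (mul_nonneg (Real.sqrt_nonneg x) (pow_nonneg hlog.le 2))]
    calc |(Nat.primeCounting ⌊x⌋₊ : ℝ) - logIntegral x| * Real.log x
        ≤ C * (Real.sqrt x * Real.log x) * Real.log x :=
          mul_le_mul_of_nonneg_right (hbd x hx) hlog.le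
      _ = C * (Real.sqrt x * Real.log x ^ 2) := by ring
  -- (ii) the integral `∫₂ˣ (π(u) − li u) du/u = O(√x log x)`
  have h2 : (fun x ↦ ∫ t in (2 : ℝ)..x, ((Nat.primeCounting ⌊t⌋₊ : ℝ) - logIntegral t) / t)
      =O[atTop] fun x ↦ Real.sqrt x * Real.log x ^ 2 := by
    have h2' : (fun x ↦ ∫ t in (2 : ℝ)..x, ((Nat.primeCounting ⌊t⌋₊ : ℝ) - logIntegral t) / t)
        =O[atTop] fun x ↦ 2 * Real.sqrt x * Real.log x := by
      refine isBigO_intervalIntegral_of_abs_le (h := fun t ↦ (Real.sqrt t)⁻¹ * Real.log t) hT2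
        hC0.le (fun x hx ↦ intervalIntegrable_primeCounting_sub_logIntegral_div (by linarith))
        ?_ ?_ (fun x hx ↦ integral_inv_sqrt_mul_log_le (by linarith) hx) ?_
      · refine ContinuousOn.mul (Real.continuous_sqrt.continuousOn.inv₀ fun t ht ↦ ?_)
          (Real.continuousOn_log.mono fun t ht ↦ ?_)
        · have ht0 : 0 < t := by linarith [mem_Ici.1 ht]
          exact (Real.sqrt_pos.2 ht0).ne'
        · have ht0 : 0 < t := by linarith [mem_Ici.1 ht]
          simp only [mem_compl_iff, mem_singleton_iff]
          exact ht0.ne'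
      · intro t ht
        have ht0 : 0 < t := by linarith
        have hst : 0 < Real.sqrt t := Real.sqrt_pos.2 ht0
        rw [abs_div, abs_of_pos ht0, div_le_iff₀ ht0]
        calc |(Nat.primeCounting ⌊t⌋₊ : ℝ) - logIntegral t| ≤ C * (Real.sqrt t * Real.log t) :=
              hbd t ht
          _ = C * ((Real.sqrt t)⁻¹ * Real.log t) * t := by
              rw [← Real.sqrt_div_self]
              field_simp
      · filter_upwards [eventually_one_le_sqrt_and_log] with x hx
        nlinarith [hx.1, hx.2]
    refine h2'.trans (IsBigO.of_bound 2 ?_)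
    filter_upwards [eventually_one_le_sqrt_and_log] with x hx
    have hlog : 0 ≤ Real.log x := zero_le_one.trans hx.2
    rw [Real.norm_eq_abs, Real.norm_eq_abs,
      abs_of_nonneg (mul_nonneg (mul_nonneg zero_le_two (Real.sqrt_nonneg x)) hlog),
      abs_of_nonneg (mul_nonneg (Real.sqrt_nonneg x) (pow_nonneg hlog 2))]
    nlinarith [mul_nonneg (mul_nonneg (Real.sqrt_nonneg x) hlog) (sub_nonneg.2 hx.2)]
  -- (iii) the constant
  have h3 := isBigO_const_of_one_le (b := fun x ↦ Real.sqrt x * Real.log x ^ 2) ?_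
    (logIntegral 2 * Real.log 2 - 2)
  · refine ((h1.sub h2).add h3).congr' ?_ EventuallyEq.rfl
    filter_upwards [eventually_ge_atTop 2] with x hx
    exact (theta_sub_self_eq hx).symm
  · filter_upwards [eventually_one_le_sqrt_and_log] with x hx
    nlinarith [hx.1, hx.2, mul_nonneg (zero_le_one.trans hx.1) (zero_le_one.trans hx.2)]

end VonKochTransfer

open VonKochTransfer

/-! ### Assembly -/

/-- **von Koch's theorem** (von Koch 1901, Note additionnelle, p. 182; Montgomery–Vaughan
Thm. 13.1, (13.4)): the Riemann hypothesis implies `π(x) − li(x) = O(√x log x)`.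
[cite: Koch1901, Note additionnelle p. 182] -/
theorem primeCounting_sub_logIntegral_isBigO_of_riemannHypothesis (hRH : RiemannHypothesis) :
    (fun x : ℝ ↦ (Nat.primeCounting ⌊x⌋₊ : ℝ) - logIntegral x) =O[atTop]
      fun x ↦ Real.sqrt x * Real.log x :=
  isBigO_primeCounting_sub_logIntegral_of_theta
    (riemannHypothesis_iff_chebyshevTheta_isBigO_holds.mp hRH)

/-- **The converse of von Koch's theorem** (Montgomery–Vaughan §15.1): `π(x) − li(x) = O(√x log x)`
implies the Riemann hypothesis (via `θ(x) − x = O(x^{1/2} log² x)` and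
`Literature.NumberTheory.LFunctions.riemannHypothesis_iff_chebyshevTheta_isBigO_holds`).
[cite: MontgomeryVaughan2007, §15.1 (with Thm. 1.3)] -/
theorem riemannHypothesis_of_primeCounting_sub_logIntegral_isBigO
    (hπ : (fun x : ℝ ↦ (Nat.primeCounting ⌊x⌋₊ : ℝ) - logIntegral x) =O[atTop]
      fun x ↦ Real.sqrt x * Real.log x) :
    RiemannHypothesis :=
  riemannHypothesis_iff_chebyshevTheta_isBigO_holds.mpr
    (isBigO_theta_of_primeCounting_sub_logIntegral hπ)

/-- **rh.S20 discharged: von Koch's criterion** `RH ↔ π(x) − li(x) = O(√x log x)`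
(von Koch 1901, Note additionnelle, p. 182, for `⇒`; Montgomery–Vaughan Thm. 13.1 (13.4) and
§15.1 for the equivalence). Discharge of the named fact `Literature.NumberTheory.LFunctions.von_koch`; users holding
`(h : von_koch)` are fed `von_koch_holds`. [cite: Koch1901, Note additionnelle p. 182] -/
theorem von_koch_holds : von_koch :=
  Iff.intro primeCounting_sub_logIntegral_isBigO_of_riemannHypothesis
    riemannHypothesis_of_primeCounting_sub_logIntegral_isBigO

end Literature.NumberTheory.LFunctions

end
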